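import Summits.NavierStokesRegularity.FluidComputer.GateBudgetDLedgerSum
import HarnessLib

/-!
# GateBudget part 82 — the two-sided clean ladder: the pair budget run on the ledgers (§239–§240)

Cell `pub-fluidc`, blueprint seat bp1 (gen 37, first item: THE TWO-SIDED LADDER I, SPEC-INPUT-bp1
§BM(4)(a)–(c)); namespace `Summit.NavierStokesRegularity.FluidComputer.GateBudget`, headline
member `RotorKnob.rotorCircuit K K¹⁰ ε ρ` of the two-scale family from `delayInit` (5.6),
`K ≥ 16`, on the lattice window `200ε/K²⁰ ≤ ρ² ≤ 2ε/K¹⁰`, `ε² ≤ 1/(6K²⁰)`, `ε = kK¹⁰ρ²`;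
modes `0 = a` (carrier), `1 = b` (clock), `2 = c` (trigger), `3 = d` (transfer), `4 = ã`
(output). HONEST FRAMING: a low prior, high value-of-information experiment on Tao's machine
paradigm; NOT a claim that NS blows up.

WHAT. Parts 67/81 climb the clean misfire ladder `r₁ = r₀, r_{n+1} = r'_n` paying part 66's
PAIR SLIP `s′ = 0.3(η′ + 310 log K/K⁹) + 6/K⁹ ≈ 93 log K/K⁹` per rung, so the pair budget
`P = d² + ã² ≤ 1/50` lasts `≈ 1.3·10⁻⁴K⁹/log K` rungs — SHORTER than the clock window
`(N - 1)·286/K⁹ ≤ 0.15`. §240 `knob_ladder_climb_two_sided` re-runs the same induction (part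
67 §208's hypotheses on the anchor and the clock, part 81 §238's three ledger invariants) but
carries the pair energy on the LEDGERS of part 80 §236 instead: per rung `P(r') ≤ P(r) + S` for
any real `S` dominating the LEDGER SLIP `(0.2829 + U/K⁹)·U/K⁹ + (2D + ι)ι + 6/K⁹`, where `U ≥
7/2 + k²/3 + (2 log k + 520 log K)·D²` (part 80's output ceiling at transfer level `D`), `D ≥ D₀
+ (1 + (10/9)K⁴)·J` (part 81's uniform transfer bound, `J = ((61/12)k + 2/3)/K¹⁰ + 3/K⁹`) and
`ι = (2k + 3)/(5K⁹)` (part 80's transfer injection at output level `≤ 3/20`). The budget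
hypothesis becomes `P₁ + s′ + (N - 1)·S ≤ 1/50` — part 66's slip `s′` is paid ONCE (its rung
map asks for it as standing reserve), the ledger slip `S` per rung. §240 `knob_ladder_two_sided`
reads the invariants out uniformly in `n`: `P(rₙ) ≤ 1/50`, `(n - 1)/K⁹ + A₀ ≤ ã(rₙ) ≤ 0.1415`,
`|d(rₙ)| ≤ D`.
HOW (§239, pure real analysis). `pulse_pslip`: `0 ≤ a ≤ a' ≤ a + u`, `a² ≤ 1/50`, `|d'| ≤ |d| +
ι`, `|d| ≤ D` ⇒ `d'² + a'² ≤ d² + a² + (0.2829 + u)u + (2D + ι)ι` (`2a ≤ 0.2829`);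
`iota_numerics`: `(5k + (k/2 + 4)x)/K¹⁰ ≤ (2k + 3)/(5K⁹)` for `0 ≤ x ≤ (3/20)K`;
`pulse_gain_crude`: `K·(241 log K/K¹⁰) ≤ 10⁻³` (so the exit level is `≤ 0.1415 + 10⁻³ ≤ 3/20`).
The COLD CONVERSION is part 56's `knob_pair_dose` with `c ≤ ρ²/K⁹`, `|d| ≤ 1` on `[T', r']`,
`r' < T' + 3`: `|P(r') - P(T')| ≤ 6/K⁹` — on the cold phase `P` is transferred (`d² → ã²`), not
created. §240 is then part 81 §238 line by line plus these four facts per rung.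
READING (SPEC-INPUT-bp1 §BM(4)). With the member-wise anchor of parts 49/51 (`D₀ = ψ₁ + 245/K⁸`,
`ψ₁ = kπ/(0.49K¹⁰ - 1) + 2/K¹⁰`) the `log K` of `U` multiplies `D²` (`D = 7/K⁴` serves for all
`k ≤ K²`): the slip is `S = (7 + k²/10)/K⁹`, LOG-FREE, and for `k ≤ 18` the pair window contains
the clock window — that read-out (anchor + numerics) is part 83, not here.
HONEST LIMITS. (i) `A₀, D₀, P₁` and the dominating reals `D, U, S` are free inputs constrained
by three explicit inequalities — this file proves no numerics about them; (ii) existence per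
rung as in parts 67/81 (no uniqueness); (iii) the clock hypotheses are part 67's verbatim
(`286/K⁹` drift per rung, window `0.14999`) — the clock side is NOT improved here; (iv) constants
generous (`0.2829` for `2√(1/50)`, `6/K⁹` where `3/K⁹` is true, `ι` uses `ã ≤ 3/20`); (v) the
fine output ceiling `U/K⁹` beats part 66's crude `241 log K/K⁹` only when `k² ≲ 723 log K` —
both remain available; (vi) nothing about Navier–Stokes.
[cite: Tao2016AveragedNS, §5.5 Theorem 5.3, (5.5), (5.6), (b-eq), (c-eq), (d-eq), (ta-eq),
(energy-con), (est)]
-/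

noncomputable section

namespace Summit.NavierStokesRegularity.FluidComputer.GateBudget

open Real Set Filter Topology
open Literature.Analysis.FluidPDE.Tao2016AveragedNS

variable {K ε ρ : ℝ} {X : ℝ → Fin 5 → ℝ} {C : ℝ → ℝ}

/-! ## §239 The pulse P-slip, the injection at output level `≤ 3/20`, the crude pulse gain -/

/-- §239 THE PULSE P-SLIP (pure algebra): `0 ≤ a ≤ a' ≤ a + u` with `a² ≤ 1/50`, and `|d'| ≤
|d| + ι` with `|d| ≤ D`, `ι ≥ 0` ⇒ `d'² + a'² ≤ d² + a² + (0.2829 + u)u + (2D + ι)ι`.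
[folklore] -/
theorem pulse_pslip {a a' d d' u D ι : ℝ} (ha : 0 ≤ a) (hP : a ^ 2 ≤ 1 / 50)
    (ha' : a' ≤ a + u) (haa' : a ≤ a') (hd' : |d'| ≤ |d| + ι) (hD : |d| ≤ D) (hι : 0 ≤ ι) :
    d' ^ 2 + a' ^ 2 ≤ d ^ 2 + a ^ 2 + (2829 / 10000 + u) * u + (2 * D + ι) * ι := by
  have h2a : 2 * a ≤ 2829 / 10000 := by nlinarith [ha, hP]
  have hu : 0 ≤ u := by linarith
  have hA : a' ^ 2 ≤ (a + u) ^ 2 := pow_le_pow_left₀ (ha.trans haa') ha' 2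
  have hB : |d'| ^ 2 ≤ (|d| + ι) ^ 2 := pow_le_pow_left₀ (abs_nonneg _) hd' 2
  rw [sq_abs] at hB
  have h1 : 2 * a * u ≤ 2829 / 10000 * u := mul_le_mul_of_nonneg_right h2a hu
  have h2 : 2 * |d| * ι ≤ 2 * D * ι := mul_le_mul_of_nonneg_right (by linarith) hι
  linarith [hA, hB, h1, h2, sq_abs d]

/-- §239 THE TRANSFER INJECTION AT OUTPUT LEVEL `≤ 3/20` (`K ≥ 16`, `k ≥ 0`, `0 ≤ x ≤ (3/20)K`):
`0 ≤ (5k + (k/2 + 4)x)/K¹⁰ ≤ (2k + 3)/(5K⁹)`. [folklore] -/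
theorem iota_numerics (hK : 16 ≤ K) {k x : ℝ} (hk : 0 ≤ k) (hx0 : 0 ≤ x)
    (hx : x ≤ 3 / 20 * K) :
    0 ≤ (5 * k + (k / 2 + 4) * x) / K ^ 10 ∧
      (5 * k + (k / 2 + 4) * x) / K ^ 10 ≤ (2 * k + 3) / (5 * K ^ 9) := by
  have hK0 : (0 : ℝ) < K := by linarith
  have hK9 : (0 : ℝ) < K ^ 9 := by positivity
  refine ⟨by positivity, ?_⟩
  have h1 : (k / 2 + 4) * x ≤ (k / 2 + 4) * (3 / 20 * K) :=
    mul_le_mul_of_nonneg_left hx (by positivity)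
  have hkK : 0 ≤ k * (K - 16) := mul_nonneg hk (by linarith)
  have key : (5 * k + (k / 2 + 4) * x) / K ≤ (2 * k + 3) / 5 := by
    rw [div_le_iff₀ hK0]; nlinarith [h1, hkK, hk, hK0]
  rw [show K ^ 10 = K * K ^ 9 by ring, ← div_div, ← div_div]
  exact div_le_div_of_nonneg_right key hK9.le

/-- §239 THE CRUDE PULSE GAIN IS BELOW `10⁻³` (`K ≥ 16`): `K·(241 log K/K¹⁰) ≤ 1/1000`
(`log K ≤ K`, `K⁸ ≥ 2³²`). [folklore] -/
theorem pulse_gain_crude (hK : 16 ≤ K) : K * (241 * log K / K ^ 10) ≤ 1 / 1000 := by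
  have hK0 : (0 : ℝ) < K := by linarith
  have hK8 : (0 : ℝ) < K ^ 8 := by positivity
  have hK10 : (0 : ℝ) < K ^ 10 := by positivity
  have h8 : (4294967296 : ℝ) ≤ K ^ 8 := by
    have := headline_pow_floor hK 8; norm_num at this; exact this
  have hlogK : log K ≤ K := by linarith only [Real.log_le_sub_one_of_pos hK0]
  have h1 : 241 * log K / K ^ 10 ≤ 241 * K / K ^ 10 :=
    div_le_div_of_nonneg_right (by linarith only [hlogK]) hK10.le
  have h2 : K * (241 * K / K ^ 10) = 241 / K ^ 8 := by field_simp
  have h3 : (241 : ℝ) / K ^ 8 ≤ 1 / 1000 := by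
    rw [div_le_div_iff₀ hK8 (by norm_num)]; linarith only [h8]
  calc K * (241 * log K / K ^ 10) ≤ K * (241 * K / K ^ 10) :=
        mul_le_mul_of_nonneg_left h1 hK0.le
    _ = 241 / K ^ 8 := h2
    _ ≤ 1 / 1000 := h3

/-- §239 SIGNS (`K ≥ 16`, `k ≥ 1`, `D₀ ≥ 0`): the three dominations of §240 force `0 ≤ D`,
`0 ≤ U` and `6/K⁹ ≤ S`. [folklore] -/
theorem slip_signs (hK : 16 ≤ K) {k D₀ D U S : ℝ} (hk1 : 1 ≤ k) (hD0 : 0 ≤ D₀)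
    (hD : D₀ + (1 + 10 / 9 * K ^ 4) * ((61 / 12 * k + 2 / 3) / K ^ 10 + 3 / K ^ 9) ≤ D)
    (hU : 7 / 2 + k ^ 2 / 3 + (2 * log k + 520 * log K) * D ^ 2 ≤ U)
    (hS : (2829 / 10000 + U / K ^ 9) * (U / K ^ 9)
      + (2 * D + (2 * k + 3) / (5 * K ^ 9)) * ((2 * k + 3) / (5 * K ^ 9)) + 6 / K ^ 9 ≤ S) :
    0 ≤ D ∧ 0 ≤ U ∧ 6 / K ^ 9 ≤ S := by
  have hK0 : (0 : ℝ) < K := by linarith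
  have hk0 : 0 ≤ k := by linarith
  have hJ : 0 ≤ (1 + 10 / 9 * K ^ 4) * ((61 / 12 * k + 2 / 3) / K ^ 10 + 3 / K ^ 9) := by
    positivity
  have hDpos : 0 ≤ D := by linarith only [hD0, hJ, hD]
  have hlogc : 0 ≤ 2 * log k + 520 * log K := by
    have h1 : 0 ≤ log k := Real.log_nonneg hk1
    have h2 : 0 ≤ log K := Real.log_nonneg (by linarith)
    linarith only [h1, h2]
  have hU0 : 0 ≤ U := by
    have h1 : 0 ≤ (2 * log k + 520 * log K) * D ^ 2 := mul_nonneg hlogc (sq_nonneg D)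
    have h2 : 0 ≤ k ^ 2 / 3 := by positivity
    linarith only [h1, h2, hU]
  have hι : 0 ≤ (2 * k + 3) / (5 * K ^ 9) := by positivity
  have h1 : 0 ≤ (2829 / 10000 + U / K ^ 9) * (U / K ^ 9) := by positivity
  have h2 : 0 ≤ (2 * D + (2 * k + 3) / (5 * K ^ 9)) * ((2 * k + 3) / (5 * K ^ 9)) :=
    mul_nonneg (by linarith only [hDpos, hι]) hι
  exact ⟨hDpos, hU0, by linarith only [h1, h2, hS]⟩

/-! ## §240 The two-sided climb -/

/-- §240 **THE GENERIC CLIMB, TWO-SIDED** (part 67 §208 / part 81 §238's induction with the pair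
energy carried on the ledgers). Headline member with a trigger primitive on the lattice window;
an ignition `r₀ ≥ 0` in normal form `b(r₀) = θ₀ε`, `c(r₀) = ρ²/K⁹`, `P(r₀) ≤ P₁`, with `5/4 +
(N - 1)·286/K⁹ ≤ θ₀ ≤ 29/20`, `(N - 1)·286/K⁹ ≤ 0.14999`; anchor data `0 ≤ A₀ ≤ ã(r₀)`,
`|d(r₀)| ≤ D₀`; dominating reals `D ≥ D₀ + (1 + (10/9)K⁴)J`, `U ≥ 7/2 + k²/3 + (2 log k +
520 log K)D²`, `S ≥ (0.2829 + U/K⁹)U/K⁹ + (2D + ι)ι + 6/K⁹` (`J = ((61/12)k + 2/3)/K¹⁰ + 3/K⁹`,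
`ι = (2k + 3)/(5K⁹)`); budget `P₁ + s′ + (N - 1)·S ≤ 1/50` (`s′ = 0.3(η′ + 310 log K/K⁹) +
6/K⁹` paid once) ⇒ for every `1 ≤ n ≤ N` an ignition `rₙ ≥ r₀ + (n - 1)` in normal form with
`5/4 + (N - n)·286/K⁹ ≤ θₙ ≤ 29/20`, `P(rₙ) ≤ P₁ + (n - 1)·S`, `ã(rₙ) ≥ A₀ + (n - 1)/K⁹`, and
part 81's two transfer ledgers. [derived: part 80 §236, part 81 §237–§238, part 56
`knob_pair_dose`, §239, `Nat.le_induction`] -/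
theorem knob_ladder_climb_two_sided
    (hX : ∀ t, HasDerivAt X (RotorKnob.rotorCircuit K (K ^ 10) ε ρ (X t)) t)
    (h0 : X 0 = delayInit) (hC : ∀ t, HasDerivAt C (X t 2) t) (hK : 16 ≤ K)
    (hε : 0 < ε) (hεK : ε ^ 2 ≤ 1 / (6 * K ^ 20)) (hρ : 0 < ρ)
    (hlo : 200 * ε / K ^ 20 ≤ ρ ^ 2) (hhi : K ^ 10 * ρ ^ 2 ≤ 2 * ε) (k : ℕ)
    (hk : ε = k * K ^ 10 * ρ ^ 2) {r₀ θ₀ P₁ A₀ D₀ D U S : ℝ} {N : ℕ} (hr₀ : 0 ≤ r₀)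
    (hb₀ : X r₀ 1 = θ₀ * ε) (hc₀ : X r₀ 2 = ρ ^ 2 / K ^ 9) (hP₁ : X r₀ 3 ^ 2 + X r₀ 4 ^ 2 ≤ P₁)
    (hθ₀lo : 5 / 4 + ((N : ℝ) - 1) * (286 / K ^ 9) ≤ θ₀) (hθ₀hi : θ₀ ≤ 29 / 20)
    (hNθ : ((N : ℝ) - 1) * (286 / K ^ 9) ≤ 14999 / 100000)
    (hA0 : 0 ≤ A₀) (hA₀ : A₀ ≤ X r₀ 4) (hD₀ : |X r₀ 3| ≤ D₀)
    (hD : D₀ + (1 + 10 / 9 * K ^ 4) * ((61 / 12 * k + 2 / 3) / K ^ 10 + 3 / K ^ 9) ≤ D)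
    (hU : 7 / 2 + k ^ 2 / 3 + (2 * log k + 520 * log K) * D ^ 2 ≤ U)
    (hS : (2829 / 10000 + U / K ^ 9) * (U / K ^ 9)
      + (2 * D + (2 * k + 3) / (5 * K ^ 9)) * ((2 * k + 3) / (5 * K ^ 9)) + 6 / K ^ 9 ≤ S)
    (hNP : P₁ + (3 * (k * π / ((25 / 16 - 1 / 10 ^ 6) * K ^ 10 - 1) + 1 / K ^ 19
      + 310 * log K / K ^ 9) / 10 + 6 / K ^ 9) + ((N : ℝ) - 1) * S ≤ 1 / 50) :
    ∀ n : ℕ, 1 ≤ n → n ≤ N → ∃ r θ : ℝ, r₀ + ((n : ℝ) - 1) ≤ r ∧ X r 1 = θ * ε ∧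
      5 / 4 + ((N : ℝ) - n) * (286 / K ^ 9) ≤ θ ∧ θ ≤ 29 / 20 ∧ X r 2 = ρ ^ 2 / K ^ 9 ∧
      X r 3 ^ 2 + X r 4 ^ 2 ≤ P₁ + ((n : ℝ) - 1) * S ∧
      A₀ + ((n : ℝ) - 1) / K ^ 9 ≤ X r 4 ∧
      |X r 3| ≤ D₀ + ((n : ℝ) - 1) * ((61 / 12 * k + 2 / 3) / K ^ 10 + 3 / K ^ 9) ∧
      |X r 3| ≤ D₀ + (1 + 10 / 9 * K ^ 8 / n) * ((61 / 12 * k + 2 / 3) / K ^ 10 + 3 / K ^ 9) := by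
  obtain ⟨hk1, -, -, hδ0, -, -⟩ := rung_numerics hK hε hρ hlo k hk
  have hK0 : (0 : ℝ) < K := by linarith
  have hK8 : (0 : ℝ) < K ^ 8 := by positivity
  have hK9 : (0 : ℝ) < K ^ 9 := by positivity
  have hK10 : (0 : ℝ) < K ^ 10 := by positivity
  have hk0 : (0 : ℝ) ≤ k := Nat.cast_nonneg k
  have h286 : (0 : ℝ) ≤ 286 / K ^ 9 := by positivity
  have hlogK : 0 ≤ log K := Real.log_nonneg (by linarith)
  have h310 : (0 : ℝ) ≤ 310 * log K / K ^ 9 := div_nonneg (by positivity) hK9.le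
  have h6 : (0 : ℝ) ≤ 6 / K ^ 9 := by positivity
  have hD0 : 0 ≤ D₀ := le_trans (abs_nonneg _) hD₀
  obtain ⟨s, hs_def⟩ : ∃ s : ℝ, s = 3 * (k * π / ((25 / 16 - 1 / 10 ^ 6) * K ^ 10 - 1)
      + 1 / K ^ 19 + 310 * log K / K ^ 9) / 10 + 6 / K ^ 9 := ⟨_, rfl⟩
  have hs0 : 0 ≤ s := by rw [hs_def]; linarith only [hδ0, h310, h6]
  obtain ⟨J, hJ_def⟩ : ∃ J : ℝ, J = (61 / 12 * k + 2 / 3) / K ^ 10 + 3 / K ^ 9 := ⟨_, rfl⟩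
  have hJ0 : 0 ≤ J := by rw [hJ_def]; positivity
  obtain ⟨ι, hι_def⟩ : ∃ ι : ℝ, ι = (2 * k + 3) / (5 * K ^ 9) := ⟨_, rfl⟩
  have hι0 : 0 ≤ ι := by rw [hι_def]; positivity
  obtain ⟨-, -, hS6⟩ := slip_signs hK hk1 hD0 hD hU hS
  have hS0 : 0 ≤ S := h6.trans hS6
  have hlogc : 0 ≤ 2 * log k + 520 * log K := by
    have : 0 ≤ log (k : ℝ) := Real.log_nonneg hk1
    linarith only [this, hlogK]
  simp only [← hs_def, ← hJ_def, ← hι_def] at hNP hD hS ⊢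
  intro n hn
  induction n, hn using Nat.le_induction with
  | base =>
    intro _
    refine ⟨r₀, θ₀, by simp, hb₀, by simpa using hθ₀lo, hθ₀hi, hc₀, by simpa using hP₁,
      by simpa using hA₀, by simpa using hD₀, ?_⟩
    have : 0 ≤ (1 + 10 / 9 * K ^ 8) * J := mul_nonneg (by positivity) hJ0
    norm_num; linarith only [hD₀, this]
  | succ m hm ih =>
    intro hmN
    obtain ⟨r, θ, hr, hb, hθlo, hθhi, hc, hP, hA, hd1, hd2⟩ := ih (Nat.le_of_succ_le hmN)
    have hm1 : (1 : ℝ) ≤ m := by exact_mod_cast hm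
    have hmN' : (m : ℝ) + 1 ≤ N := by exact_mod_cast hmN
    have hNm : 0 ≤ ((N : ℝ) - m) * (286 / K ^ 9) := mul_nonneg (by linarith) h286
    have hmq : 0 ≤ (m : ℝ) * (286 / K ^ 9) := mul_nonneg (by linarith) h286
    have hr0 : 0 ≤ r := by linarith only [hr₀, hr, hm1]
    have hθ1 : 5 / 4 ≤ θ := by linarith only [hθlo, hNm]
    have hmS : ((m : ℝ) - 1) * S ≤ ((N : ℝ) - 1) * S - S := by
      have := mul_nonneg (sub_nonneg.2 hmN') hS0
      linarith only [this]
    have hP50 : X r 3 ^ 2 + X r 4 ^ 2 + s ≤ 1 / 50 := by linarith only [hP, hNP, hmS, hS0]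
    have hPr : X r 3 ^ 2 + X r 4 ^ 2 + 3 * (k * π / ((25 / 16 - 1 / 10 ^ 6) * K ^ 10 - 1)
        + 1 / K ^ 19 + 310 * log K / K ^ 9) / 10 + 6 / K ^ 9 ≤ 1 / 50 := by
      rw [hs_def] at hP50; linarith only [hP50]
    obtain ⟨T', θ₁, tz, r', θ', ⟨hrT, -, -, -, -, -, -, -, -, he0, hecr⟩,
        ⟨htz1, -, htz2, hr'3, hcold, hc'⟩, ⟨hb', hθ'hi, hθ'lo, -, hrr'⟩, hfl, hceil, hdT, -,
        hdr', hmono, -⟩ :=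
      knob_rung_ledger hX h0 hC hK hε hεK hρ hlo hhi k hk hr0 hθ1 hθhi hb hc hPr
    have hT'0 : 0 ≤ T' := by linarith only [hr0, hrT]
    have hTr' : T' ≤ r' := by linarith only [htz1, htz2]
    have em1 : ((m : ℝ) - 1) + 1 = m := by ring
    -- the pair slip on the ledgers: pulse (§239) + cold conversion (part 56)
    have hdD : |X r 3| ≤ D :=
      (ledger_invariant_final hK0 hJ0 (by linarith) hd1 (by rw [em1]; exact hd2)).trans hD
    have ha0 : 0 ≤ X r 4 := le_trans (add_nonneg hA0 (div_nonneg (by linarith) hK9.le)) hA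
    have haP : X r 4 ^ 2 ≤ 1 / 50 := by nlinarith only [hP50, hs0, sq_nonneg (X r 3)]
    have heT : K * X T' 4 ≤ 3 / 20 * K := by
      have h2a : X r 4 ≤ 1415 / 10000 := by nlinarith only [haP, ha0]
      have : X T' 4 ≤ 3 / 20 := by linarith only [hecr, pulse_gain_crude hK, h2a]
      nlinarith only [this, hK0]
    obtain ⟨-, hι⟩ := iota_numerics hK hk0 (mul_nonneg hK0.le he0) heT
    rw [← hι_def] at hι
    have hdT' : |X T' 3| ≤ |X r 3| + ι := by linarith only [hdT, hι]
    have hd2D : X r 3 ^ 2 ≤ D ^ 2 := by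
      have := pow_le_pow_left₀ (abs_nonneg _) hdD 2
      rwa [sq_abs] at this
    have hUr : 7 / 2 + k ^ 2 / 3 + (2 * log k + 520 * log K) * X r 3 ^ 2 ≤ U := by
      have := mul_le_mul_of_nonneg_left hd2D hlogc
      linarith only [this, hU]
    have haT' : X T' 4 ≤ X r 4 + U / K ^ 9 := by
      linarith only [hceil, div_le_div_of_nonneg_right hUr hK9.le]
    have haa' : X r 4 ≤ X T' 4 := by
      have : (0 : ℝ) < 1 / K ^ 9 := by positivity
      linarith only [hfl, this]
    have slip := pulse_pslip ha0 haP haT' haa' hdT' hdD hι0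
    have hρ2 : ρ ^ 2 ≠ 0 := by positivity
    have hdose := knob_pair_dose hX h0 hT'0 hcold
      (fun t _ => RotorKnob.traj_abs_le_one hX h0 t 3) (right_mem_Icc.2 hTr')
    have e6 : 2 * (ρ ^ 2)⁻¹ * (ρ ^ 2 / K ^ 9) * 1 * (r' - T') = 2 * (r' - T') / K ^ 9 := by
      field_simp
    have h26 : 2 * (r' - T') / K ^ 9 ≤ 6 / K ^ 9 :=
      div_le_div_of_nonneg_right (by linarith only [hr'3]) hK9.le
    have hP's : X r' 3 ^ 2 + X r' 4 ^ 2 ≤ X r 3 ^ 2 + X r 4 ^ 2 + S := by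
      have h1 := (abs_le.1 hdose).2
      rw [e6] at h1
      linarith only [h1, h26, slip, hS]
    -- the three ledger invariants (part 81 §238 verbatim)
    obtain ⟨x, hx⟩ : ∃ x : ℝ, x = K * X T' 4 := ⟨_, rfl⟩
    have hmK : (m : ℝ) / K ^ 9 ≤ X T' 4 := by
      have e : ((m : ℝ) - 1) / K ^ 9 + 1 / K ^ 9 = (m : ℝ) / K ^ 9 := by ring
      linarith only [hA, hfl, hA0, e]
    have hxm : (m : ℝ) / K ^ 8 ≤ x := by
      have e : K * ((m : ℝ) / K ^ 9) = (m : ℝ) / K ^ 8 := by field_simp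
      rw [hx, ← e]; exact mul_le_mul_of_nonneg_left hmK hK0.le
    have hx0 : 0 ≤ x := le_trans (by positivity) hxm
    have hq0 : 0 ≤ exp (-(9 / 4 * x)) := (exp_pos _).le
    have hq1 : exp (-(9 / 4 * x)) ≤ 1 := by rw [Real.exp_le_one_iff]; linarith
    have hinj : exp (-(9 / 4 * x)) * (5 * k + (k / 2 + 4) * x) ≤ 61 / 12 * k + 2 / 3 := by
      have f1 := mul_le_of_le_one_left (by positivity : (0 : ℝ) ≤ 5 * k) hq1
      have f2 := mul_le_mul_of_nonneg_left (injection_numerics x)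
        (by positivity : (0 : ℝ) ≤ k / 2 + 4)
      linarith [f1, f2]
    have hinj' : exp (-(9 / 4 * x)) * ((5 * k + (k / 2 + 4) * x) / K ^ 10)
        ≤ (61 / 12 * k + 2 / 3) / K ^ 10 := by
      rw [← mul_div_assoc]; exact div_le_div_of_nonneg_right hinj hK10.le
    rw [← hx] at hdT hdr'
    have hprod := mul_le_mul_of_nonneg_right hdT hq0
    have hrec : |X r' 3| ≤ exp (-(9 / 4 * x)) * |X r 3| + J := by
      rw [hJ_def]; linarith [hdr', hprod, hinj']
    have hy : 9 / 4 * (((m : ℝ) - 1) + 1) / K ^ 8 ≤ 9 / 4 * x := by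
      rw [em1, mul_div_assoc]; linarith only [hxm]
    obtain ⟨hd1', hd2'⟩ := ledger_invariant_step hK0 hJ0 hD0 (abs_nonneg _) (by linarith) hy
      hd1 (by rw [em1]; exact hd2) hrec
    have em : ((m : ℝ) - 1) + 2 = (m : ℝ) + 1 := by ring
    rw [em] at hd2'
    refine ⟨r', θ', ?_, hb', ?_, by linarith only [hθ'hi], hc', ?_, ?_, ?_, ?_⟩
    · push_cast; linarith only [hr, hrr']
    · push_cast
      rcases hθ'lo with h | h
      · linarith only [hθlo, h]
      · linarith only [hNθ, h, hmq]
    · push_cast; linarith only [hP, hP's]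
    · have e' : (((m + 1 : ℕ) : ℝ) - 1) / K ^ 9 = ((m : ℝ) - 1) / K ^ 9 + 1 / K ^ 9 := by
        push_cast; ring
      linarith only [hA, hfl, hmono, e']
    · push_cast; linarith only [hd1']
    · push_cast; exact hd2'

/-- §240 **THE TWO-SIDED CONTROL, READ OUT**: under §240 `knob_ladder_climb_two_sided`'s
hypotheses, at every rung `1 ≤ n ≤ N` the ignition `rₙ ≥ r₀ + (n - 1)` is in normal form with
`5/4 ≤ θₙ ≤ 29/20` and the pair is pinned from both sides, uniformly in `n`: `P(rₙ) ≤ P₁ +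
(n - 1)·S ≤ 1/50`, `A₀ + (n - 1)/K⁹ ≤ ã(rₙ) ≤ 0.1415`, `|d(rₙ)| ≤ D`.
[derived: this file §240, part 81 §237] -/
theorem knob_ladder_two_sided
    (hX : ∀ t, HasDerivAt X (RotorKnob.rotorCircuit K (K ^ 10) ε ρ (X t)) t)
    (h0 : X 0 = delayInit) (hC : ∀ t, HasDerivAt C (X t 2) t) (hK : 16 ≤ K)
    (hε : 0 < ε) (hεK : ε ^ 2 ≤ 1 / (6 * K ^ 20)) (hρ : 0 < ρ)
    (hlo : 200 * ε / K ^ 20 ≤ ρ ^ 2) (hhi : K ^ 10 * ρ ^ 2 ≤ 2 * ε) (k : ℕ)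
    (hk : ε = k * K ^ 10 * ρ ^ 2) {r₀ θ₀ P₁ A₀ D₀ D U S : ℝ} {N : ℕ} (hr₀ : 0 ≤ r₀)
    (hb₀ : X r₀ 1 = θ₀ * ε) (hc₀ : X r₀ 2 = ρ ^ 2 / K ^ 9) (hP₁ : X r₀ 3 ^ 2 + X r₀ 4 ^ 2 ≤ P₁)
    (hθ₀lo : 5 / 4 + ((N : ℝ) - 1) * (286 / K ^ 9) ≤ θ₀) (hθ₀hi : θ₀ ≤ 29 / 20)
    (hNθ : ((N : ℝ) - 1) * (286 / K ^ 9) ≤ 14999 / 100000)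
    (hA0 : 0 ≤ A₀) (hA₀ : A₀ ≤ X r₀ 4) (hD₀ : |X r₀ 3| ≤ D₀)
    (hD : D₀ + (1 + 10 / 9 * K ^ 4) * ((61 / 12 * k + 2 / 3) / K ^ 10 + 3 / K ^ 9) ≤ D)
    (hU : 7 / 2 + k ^ 2 / 3 + (2 * log k + 520 * log K) * D ^ 2 ≤ U)
    (hS : (2829 / 10000 + U / K ^ 9) * (U / K ^ 9)
      + (2 * D + (2 * k + 3) / (5 * K ^ 9)) * ((2 * k + 3) / (5 * K ^ 9)) + 6 / K ^ 9 ≤ S)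
    (hNP : P₁ + (3 * (k * π / ((25 / 16 - 1 / 10 ^ 6) * K ^ 10 - 1) + 1 / K ^ 19
      + 310 * log K / K ^ 9) / 10 + 6 / K ^ 9) + ((N : ℝ) - 1) * S ≤ 1 / 50) :
    ∀ n : ℕ, 1 ≤ n → n ≤ N → ∃ r θ : ℝ, r₀ + ((n : ℝ) - 1) ≤ r ∧ X r 1 = θ * ε ∧
      5 / 4 ≤ θ ∧ θ ≤ 29 / 20 ∧ X r 2 = ρ ^ 2 / K ^ 9 ∧
      X r 3 ^ 2 + X r 4 ^ 2 ≤ P₁ + ((n : ℝ) - 1) * S ∧ X r 3 ^ 2 + X r 4 ^ 2 ≤ 1 / 50 ∧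
      A₀ + ((n : ℝ) - 1) / K ^ 9 ≤ X r 4 ∧ X r 4 ≤ 1415 / 10000 ∧ |X r 3| ≤ D := by
  intro n hn hnN
  obtain ⟨r, θ, hr, hb, hθlo, hθhi, hc, hP, hA, hd1, hd2⟩ := knob_ladder_climb_two_sided hX h0
    hC hK hε hεK hρ hlo hhi k hk hr₀ hb₀ hc₀ hP₁ hθ₀lo hθ₀hi hNθ hA0 hA₀ hD₀ hD hU hS hNP n hn hnN
  obtain ⟨hk1, -, -, hδ0, -, -⟩ := rung_numerics hK hε hρ hlo k hk
  have hK0 : (0 : ℝ) < K := by linarith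
  have hK9 : (0 : ℝ) < K ^ 9 := by positivity
  have hn1 : (1 : ℝ) ≤ n := by exact_mod_cast hn
  have hnN' : (n : ℝ) ≤ N := by exact_mod_cast hnN
  obtain ⟨-, -, hS6⟩ := slip_signs hK hk1 ((abs_nonneg _).trans hD₀) hD hU hS
  have hS0 : 0 ≤ S := le_trans (by positivity) hS6
  have h310 : (0 : ℝ) ≤ 310 * log K / K ^ 9 :=
    div_nonneg (mul_nonneg (by norm_num) (Real.log_nonneg (by linarith))) hK9.le
  have hθ : 5 / 4 ≤ θ := by
    have := mul_nonneg (sub_nonneg.2 hnN') (by positivity : (0 : ℝ) ≤ 286 / K ^ 9)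
    linarith only [hθlo, this]
  have hP50 : X r 3 ^ 2 + X r 4 ^ 2 ≤ 1 / 50 := by
    have h1 : ((n : ℝ) - 1) * S ≤ ((N : ℝ) - 1) * S :=
      mul_le_mul_of_nonneg_right (by linarith only [hnN']) hS0
    have h2 : (0 : ℝ) ≤ 6 / K ^ 9 := by positivity
    linarith only [hP, h1, hNP, hδ0, h310, h2]
  have ha0 : 0 ≤ X r 4 := le_trans (add_nonneg hA0 (div_nonneg (by linarith) hK9.le)) hA
  have ha : X r 4 ≤ 1415 / 10000 := by nlinarith only [hP50, ha0, sq_nonneg (X r 3)]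
  have e : ((n : ℝ) - 1) + 1 = n := by ring
  have hd : |X r 3| ≤ D :=
    (ledger_invariant_final hK0 (by positivity) (by linarith) hd1 (by rw [e]; exact hd2)).trans hD
  exact ⟨r, θ, hr, hb, hθ, hθhi, hc, hP, hP50, hA, ha, hd⟩

end Summit.NavierStokesRegularity.FluidComputer.GateBudget

end
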